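import Mathlib
import HarnessLib
import Summits.HubbardSuperconductivity.HubbardSuperconductivity.Theorems.KLProgrammeC4aFoldBoxPreLaw
import Summits.HubbardSuperconductivity.HubbardSuperconductivity.Theorems.KLProgrammeC4aPreCausticLevelLineDiagonal

/-!
# Route `KLProgramme` — crux C4a, S3 brick (B4) «(U1)-LAWS» part 5f: the PRE-CAUSTIC (N2) FIRST-ORDER LAW FOR THE PARTNER BAND, BELOW THE FERMI LEVEL —
# `∫dy |∫ds w·X·∂_uK(−s, ē(−s,y))| ≤ A⁻·lo·(m₀⁻¹(√m₀)⁻¹)`, `m₀ = max(δ₀, lo)`: the `hpre` hypothesis for NEGATIVE loop levels is ONE CALL, with `B = B′ = 0`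

Cell `gate-hubbard-kl`, seat hubbard-kl-k3c3-p3 (g32; row «implicit-function / monotonicity route for μ(n)»).  Located brick for the (C)-closer lane / the (M4)
assembly of the umklapp first-order ϑ-layer (stub (C) `stub_twoLeg_curvature` of `KLRegimeEngineV17F2`, stmt-HubbardSuperconductivity-20437), memo
HOME/hubbard-kl-k3c3-p3/U1-CAUSTIC-SUP.md §12 («(U1)-NEG-PRE»).

THE GEOMETRY (this row's way: rate window + convexity of the level-`0` band; no implicit function, no caustic budget).  On the PRE side (`δ₀ = inf_{[α,β]} ē(0,·) > 0`)
the partner level of a loop momentum BELOW the Fermi level, `ē(−s,y) = e_K(S − Φ(−s, y+θ))`, `s ∈ [lo,hi]`, sits on the DIAGONAL: `|ē(−s,y) − s − D(y)| ≤ s/2`,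
`D(y) = ē(0,y) ≥ δ₀ + (c/2)(y − v*)²` (`…C4aPartnerBandLevelRate.partnerBand_level_rate_window` on `[−s, 0]` + `…C4aFoldLevelSets.fold_quadratic`), so loop and partner
levels have OPPOSITE signs and the kernel `u ↦ K(−s,u)` is the mixed-sign pair kernel (≡ 0 at `T = 0` with sharp propagators; thermal / shell-sized otherwise).  Part 5e
(`…C4aPreCausticLevelLineDiagonal.abs_intervalIntegral_levelLine_diagonal_le`) prices that line by `5WX₀Mρ·lo/max(D(y),lo)²` from a DIAGONAL MAJORANT `ρ` of the kernel with
the tail law `∫_a^hi ρ ≤ Mρ·lo·(lo/a)²`; the (N2) loop-angle layer (`…C4aPreCausticAngleLayer`, `A₂ = A₃ = 0`) then gives the sharp `hpre` size with NO `B`, `B′` rows.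
* §1 **`abs_levelLine_partnerBand_pre_below_le`**: the level line at one loop angle `y` with `D(y) > 0` and the rate window on `[−hi, 0]`.
* §2 **`intervalIntegral_partnerBand_pre_below_le`** (HEADLINE): package hypotheses of `…C4aFoldBoxPartnerBandLaws.partnerBand_foldBox_package` + levels `0 < lo ≤ hi < r` +
  kernel rows for the depth-indexed kernel `K s = K(−s,·)` (`|(K s)′u| ≤ ρ(s)/max(u − s, lo)²` for `u ≥ s/2`, `ρ ≥ 0` continuous, tail law `Mρ`; jointly continuous `∂_uK`) +
  weight `|X| ≤ X₀` (continuous in `s`) + profile `0 ≤ w ≤ W` continuous + PRE SIDE `δ₀ > 0` ⟹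
  `∫_{α..β} |∫_{lo..hi} w(s)·X(s,y)·(K s)′(e_K(S − Φ(−s, y+θ))) ds| dy ≤ (32·(5WX₀Mρ)/(3√c))·(lo·((max |δ₀| lo)⁻¹·(√(max |δ₀| lo))⁻¹))`, `c = w·u_min²/2`
  — the `hpre` shape of `…C4aCausticWindowDispatch.intervalIntegral_caustic_dispatch_log_le` with `A = 160WX₀Mρ/(3√c)`, `B = B′ = 0` (loop levels `−s`; sum with part 5d's
  bound for the levels `+e` to serve one `F(ϑ)`).
WHAT THE KERNEL SIDE OWES (k3c3-p1's currency, stated here so the closer can key it): the plain signed envelope `|∂ᵤK| ≤ C/max(s,|u|)²` is NOT enough on this side (it gives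
`≍ 1/max(D,lo)` per line, `(√max(δ₀,lo))⁻¹` per window and `log(1/lo)` across a pre-side double zero of the offset); the diagonal majorant is what the true kernel has:
in the far-far region the mixed-sign kernel is thermal, `[tanh(βu/2) − tanh(βs/2)]/(2(u−s))`, with `|∂ᵤ| ≤ e^{−β·min(s,u)}·min((u−s)⁻², β²/2)`, i.e. `ρ(s) ≍ max(1,(β·lo)²)e^{−βs/2}`
and `Mρ` a function of `β·lo` (part 5e §1 `intervalIntegral_exp_tail_le`); near the shell (`s ≤ 2lo`) the envelope itself is of majorant form.
Sizes binder shape + `GeomConstants`; nothing asserts (C), K3 or superconductivity.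
References: FST II CPAM 51 (1998) §3 [cite: FeldmanSalmhoferTrubowitz1998]; Salmhofer 1999 §4.5.3 [cite: Salmhofer1999].
-/

noncomputable section

namespace Summit.HubbardSuperconductivity.HubbardSuperconductivity.Theorems.C4a

set_option linter.dupNamespace false -- summit = problem name (single-conjunct summit), D-0017

open Real Set MeasureTheory intervalIntegral
open Literature.MathematicalPhysics.QuantumLattice Literature.MathematicalPhysics.QuantumLattice.BandSectorCounting
open Literature.MathematicalPhysics.QuantumLattice.FermiRG
open Summit.HubbardSuperconductivity.HubbardSuperconductivity.Theorems.KLRegimeSplit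
open Summit.HubbardSuperconductivity.HubbardSuperconductivity.Theorems.DispersionFlow
open Summit.HubbardSuperconductivity.HubbardSuperconductivity.Theorems.PerturbedFermiCurve

section Sizes

variable {K : TrigPolyC4v} {A : ℝ} (hA : ∀ p : Momentum, ∀ j ≤ 2, ‖iteratedFDeriv ℝ j (frameShift K) p‖ ≤ A) (hA20 : A ≤ 1 / 20)
  (hd : klCurveD ≤ (bandBounds (show (-4 : ℝ) < -1.1 by norm_num) (show (-1.1 : ℝ) ≤ -0.1 by norm_num)
    (show (-0.1 : ℝ) < 0 by norm_num)).Dtmin - 2 * A)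
  {μ r : ℝ} (hr : 0 < r) (hlo : (-1.1 : ℝ) < μ - r - A) (hhi : μ + r + A < -0.1)
  {A₃ A₄ : ℝ} (hA₃ : ∀ p : Momentum, ‖iteratedFDeriv ℝ 3 (frameShift K) p‖ ≤ A₃)
  (hA₄ : ∀ p : Momentum, ‖iteratedFDeriv ℝ 4 (frameShift K) p‖ ≤ A₄)
  {K₁ K₂ K₃ : ℝ} (hK₁ : ∀ p : Momentum, ‖fderiv ℝ (frameLevel μ K) p‖ ≤ K₁) (hK₂ : ∀ p : Momentum, ‖iteratedFDeriv ℝ 2 (frameLevel μ K) p‖ ≤ K₂)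
  (hK₃ : ∀ p : Momentum, ‖iteratedFDeriv ℝ 3 (frameLevel μ K) p‖ ≤ K₃)
include hA hA20 hd hr hlo hhi hA₃ hA₄ hK₁ hK₂ hK₃

/-! ## §1 The pre-caustic level line of the partner band at one loop angle, loop levels below the Fermi level -/

omit hA20 hA₃ hA₄ hK₁ hK₃ in
/-- **THE PRE-CAUSTIC LEVEL LINE BELOW THE FERMI LEVEL.**  A loop angle `y` with `D(y) = e_K(S − Φ(0, y+θ)) > 0`; the rate window
`K₂‖S − 2πm − 2Φ(σ, y+θ)‖/(Dt−2A) ≤ 1/2` for `σ ∈ [−hi, 0]`; levels `0 < lo ≤ hi < r`; the depth-indexed kernel `K s` with the diagonal majorant `ρ` (`u ≥ s/2`), `ρ ≥ 0`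
continuous with tail law `Mρ`, jointly continuous `∂_uK`; weight `|X| ≤ X₀` continuous; profile `0 ≤ w ≤ W` continuous.  THEN
`|∫_{lo..hi} w(s)·X(s)·(K s)′(e_K(S − Φ(−s, y+θ))) ds| ≤ 5·(W·X₀·Mρ)·(lo/max(D(y),lo)²)` — the `hF` row of the (N2) angle layer with `A₂ = A₃ = 0`. -/
theorem abs_levelLine_partnerBand_pre_below_le (S : Momentum) (m : Fin 2 → ℤ) (θ : ℝ) {y lo hi X₀ W Mρ : ℝ} {Kr : ℝ → ℝ → ℝ} {X wt ρ : ℝ → ℝ}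
    (hD : 0 < frameLevel μ K (S - levelPoint μ K 0 (y + θ)))
    (hlo0 : 0 < lo) (hlohi : lo ≤ hi) (hhir : hi < r)
    (hratey : ∀ σ ∈ Icc (-hi) 0, K₂ * ‖S - WithLp.toLp 2 (fun i => 2 * π * (m i : ℝ)) - (2 : ℝ) • levelPoint μ K σ (y + θ)‖ /
        ((bandBounds (show (-4 : ℝ) < -1.1 by norm_num) (show (-1.1 : ℝ) ≤ -0.1 by norm_num) (show (-0.1 : ℝ) < 0 by norm_num)).Dtmin - 2 * A) ≤ 1 / 2)
    (hK1 : ∀ s ∈ Icc lo hi, ∀ u, s / 2 ≤ u → |deriv (Kr s) u| ≤ ρ s * ((max (u - s) lo)⁻¹ ^ 2))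
    (hρ0 : ∀ s ∈ Icc lo hi, 0 ≤ ρ s) (hρc : ContinuousOn ρ (Icc lo hi))
    (hρtail : ∀ a ∈ Icc lo hi, ∫ s in a..hi, ρ s ≤ Mρ * (lo * (lo / a) ^ 2))
    (hKc : Continuous fun p : ℝ × ℝ => deriv (Kr p.1) p.2)
    (hwc : ContinuousOn wt (Icc lo hi)) (hw0 : ∀ s ∈ Icc lo hi, 0 ≤ wt s) (hwW : ∀ s ∈ Icc lo hi, wt s ≤ W)
    (hXc : ContinuousOn X (Icc lo hi)) (hX0 : ∀ s ∈ Icc lo hi, |X s| ≤ X₀) :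
    |∫ s in lo..hi, wt s * X s * deriv (Kr s) (frameLevel μ K (S - levelPoint μ K (-s) (y + θ)))| ≤
      5 * (W * X₀ * Mρ) * (lo / (max (frameLevel μ K (S - levelPoint μ K 0 (y + θ))) lo) ^ 2) := by
  set v : Momentum := WithLp.toLp 2 (fun i => 2 * π * (m i : ℝ)) with hv
  set eb : ℝ → ℝ := fun s => frameLevel μ K (S - levelPoint μ K (-s) (y + θ)) with heb
  -- the deformation row from the rate window on `[−s, 0]`
  have hdev : ∀ s ∈ Icc lo hi, |eb s - s - frameLevel μ K (S - levelPoint μ K 0 (y + θ))| ≤ s / 2 := fun s hs => by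
    have hs0 : 0 < s := hlo0.trans_le hs.1
    have h := partnerBand_level_rate_window hA hd hlo hhi hK₂ (frameLevel_add_twoPi μ K m) S (y + θ) (show -s ≤ (0 : ℝ) by linarith)
      (show -r < -s by linarith [hs.2]) hr ?_
    · rw [heb]; simp only
      rw [abs_le]; constructor <;> linarith [h.1, h.2]
    · intro σ hσ
      exact hratey σ ⟨by linarith [hσ.1, hs.2], hσ.2⟩
  -- continuity of the partner line in the depth
  have hebc : ContinuousOn eb (Icc lo hi) := fun s hs => by
    have hsr : |(-s)| < r := by rw [abs_neg, abs_of_pos (hlo0.trans_le hs.1)]; exact lt_of_le_of_lt hs.2 hhir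
    have h := (hasDerivAt_partnerBand_level hA hd hlo hhi S hsr (y + θ)).continuousAt
    have h2 : ContinuousAt (fun s : ℝ => -s) s := continuousAt_neg
    exact (ContinuousAt.comp (g := fun s : ℝ => frameLevel μ K (S - levelPoint μ K s (y + θ))) h h2).continuousWithinAt
  -- integrability of the integrand
  have hfi : IntervalIntegrable (fun s => wt s * X s * deriv (Kr s) (eb s)) volume lo hi := by
    refine ContinuousOn.intervalIntegrable ?_
    rw [uIcc_of_le hlohi]
    have hd : ContinuousOn (fun s => deriv (Kr s) (eb s)) (Icc lo hi) :=
      hKc.comp_continuousOn (continuousOn_id.prodMk hebc)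
    exact (hwc.mul hXc).mul hd
  have hρi : IntervalIntegrable ρ volume lo hi := by
    refine ContinuousOn.intervalIntegrable ?_
    rw [uIcc_of_le hlohi]; exact hρc
  exact abs_intervalIntegral_levelLine_diagonal_le hlo0 hlohi hD hK1 hρ0 hρi hρtail hfi hw0 hwW hX0 hdev

/-! ## §2 The pre-caustic (N2) law below the Fermi level -/

/-- **THE PRE-CAUSTIC (N2) FIRST-ORDER LAW FOR THE PARTNER BAND, BELOW THE FERMI LEVEL** (HEADLINE; see the module docstring).  No caustic budget, no `Γ`,
no flatness number: the rate window, the convexity of the level-`0` band and the diagonal majorant are all it takes; the value has the dispatchers' `hpre` shape with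
`A = 32·(5WX₀Mρ)/(3√c)`, `B = B′ = 0`, `c = w·u_min²/2`. -/
theorem intervalIntegral_partnerBand_pre_below_le {Kc r₀ g₀ w : ℝ} (hG : GeomConstants (frameLevel μ K) Kc r₀ g₀ w) (S : Momentum) (m : Fin 2 → ℤ) (θ : ℝ)
    {α β x₀ Wm Wφ lo hi X₀ W Mρ : ℝ} {Kr X : ℝ → ℝ → ℝ} {wt ρ : ℝ → ℝ}
    (hx₀ : x₀ ∈ Icc α β) (hWα : Wm ≤ x₀ - α) (hWβ : Wm ≤ β - x₀) (hWφ : ∀ y ∈ Icc α β, |y - x₀| ≤ Wφ)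
    (hlo0 : 0 < lo) (hlohi : lo ≤ hi) (hhir : hi < r)
    (hδ₀ : 0 < sInf ((fun x : ℝ => frameLevel μ K (S - levelPoint μ K 0 (x + θ))) '' Icc α β))
    (hwin : ∀ e ∈ Icc (-hi) hi, ∀ y ∈ Icc α β,
      K₃ * (‖S - WithLp.toLp 2 (fun i => 2 * π * (m i : ℝ)) - (levelPoint μ K 0 (x₀ + θ) + levelPoint μ K 0 (x₀ + θ))‖ +
              |e| / ((bandBounds (show (-4 : ℝ) < -1.1 by norm_num) (show (-1.1 : ℝ) ≤ -0.1 by norm_num) (show (-0.1 : ℝ) < 0 by norm_num)).Dtmin - 2 * A) +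
              msD A₃ A₄ 1 * |y - x₀|) * msD A₃ A₄ 1 ^ 2 +
          K₂ * (radialRowOneConst A ((bandBounds (show (-4 : ℝ) < -1.1 by norm_num) (show (-1.1 : ℝ) ≤ -0.1 by norm_num) (show (-0.1 : ℝ) < 0 by norm_num)).Dtmin -
                2 * A) * |e| + msD A₃ A₄ 2 * |y - x₀|) * (msD A₃ A₄ 1 + msD A₃ A₄ 1) +
          K₂ * (‖S - WithLp.toLp 2 (fun i => 2 * π * (m i : ℝ)) - (levelPoint μ K 0 (x₀ + θ) + levelPoint μ K 0 (x₀ + θ))‖ +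
              |e| / ((bandBounds (show (-4 : ℝ) < -1.1 by norm_num) (show (-1.1 : ℝ) ≤ -0.1 by norm_num) (show (-0.1 : ℝ) < 0 by norm_num)).Dtmin - 2 * A) +
              msD A₃ A₄ 1 * |y - x₀|) * msD A₃ A₄ 2 +
          K₁ * ((uRowTwoConst A A₃ ((bandBounds (show (-4 : ℝ) < -1.1 by norm_num) (show (-1.1 : ℝ) ≤ -0.1 by norm_num) (show (-0.1 : ℝ) < 0 by norm_num)).Dtmin -
                  2 * A) +
                1 / ((bandBounds (show (-4 : ℝ) < -1.1 by norm_num) (show (-1.1 : ℝ) ≤ -0.1 by norm_num) (show (-0.1 : ℝ) < 0 by norm_num)).Dtmin - 2 * A) +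
                2 * (radialRowOneConst A ((bandBounds (show (-4 : ℝ) < -1.1 by norm_num) (show (-1.1 : ℝ) ≤ -0.1 by norm_num)
                    (show (-0.1 : ℝ) < 0 by norm_num)).Dtmin - 2 * A) -
                  1 / ((bandBounds (show (-4 : ℝ) < -1.1 by norm_num) (show (-1.1 : ℝ) ≤ -0.1 by norm_num) (show (-0.1 : ℝ) < 0 by norm_num)).Dtmin - 2 * A))) *
              |e| + msD A₃ A₄ 3 * |y - x₀|) ≤
        w * (bandBounds (show (-4 : ℝ) < -1.1 by norm_num) (show (-1.1 : ℝ) ≤ -0.1 by norm_num) (show (-0.1 : ℝ) < 0 by norm_num)).umin ^ 2)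
    (hslope : K₂ * msD A₃ A₄ 1 * (‖S - WithLp.toLp 2 (fun i => 2 * π * (m i : ℝ)) - (2 : ℝ) • levelPoint μ K 0 (x₀ + θ)‖ +
        2 * (hi / ((bandBounds (show (-4 : ℝ) < -1.1 by norm_num) (show (-1.1 : ℝ) ≤ -0.1 by norm_num) (show (-0.1 : ℝ) < 0 by norm_num)).Dtmin - 2 * A))) ≤
      w * (bandBounds (show (-4 : ℝ) < -1.1 by norm_num) (show (-1.1 : ℝ) ≤ -0.1 by norm_num) (show (-0.1 : ℝ) < 0 by norm_num)).umin ^ 2 * Wm)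
    (hrate : K₂ * (‖S - WithLp.toLp 2 (fun i => 2 * π * (m i : ℝ)) - (2 : ℝ) • levelPoint μ K 0 (x₀ + θ)‖ +
          2 * (hi / ((bandBounds (show (-4 : ℝ) < -1.1 by norm_num) (show (-1.1 : ℝ) ≤ -0.1 by norm_num) (show (-0.1 : ℝ) < 0 by norm_num)).Dtmin - 2 * A) +
            msD A₃ A₄ 1 * Wφ)) /
        ((bandBounds (show (-4 : ℝ) < -1.1 by norm_num) (show (-1.1 : ℝ) ≤ -0.1 by norm_num) (show (-0.1 : ℝ) < 0 by norm_num)).Dtmin - 2 * A) ≤ 1 / 2)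
    (hK1 : ∀ s ∈ Icc lo hi, ∀ u, s / 2 ≤ u → |deriv (Kr s) u| ≤ ρ s * ((max (u - s) lo)⁻¹ ^ 2))
    (hρ0 : ∀ s ∈ Icc lo hi, 0 ≤ ρ s) (hρc : ContinuousOn ρ (Icc lo hi))
    (hρtail : ∀ a ∈ Icc lo hi, ∫ s in a..hi, ρ s ≤ Mρ * (lo * (lo / a) ^ 2))
    (hKc : Continuous fun p : ℝ × ℝ => deriv (Kr p.1) p.2)
    (hwc : ContinuousOn wt (Icc lo hi)) (hw0 : ∀ s ∈ Icc lo hi, 0 ≤ wt s) (hwW : ∀ s ∈ Icc lo hi, wt s ≤ W)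
    (hXc : ∀ y ∈ Icc α β, ContinuousOn (fun s => X s y) (Icc lo hi)) (hX0 : ∀ s ∈ Icc lo hi, ∀ y ∈ Icc α β, |X s y| ≤ X₀) :
    ∫ y in α..β, |∫ s in lo..hi, wt s * X s y * deriv (Kr s) (frameLevel μ K (S - levelPoint μ K (-s) (y + θ)))| ≤
      32 * (5 * (W * X₀ * Mρ)) / (3 * Real.sqrt (w * (bandBounds (show (-4 : ℝ) < -1.1 by norm_num) (show (-1.1 : ℝ) ≤ -0.1 by norm_num) (show (-0.1 : ℝ) < 0 by norm_num)).umin ^ 2 / 2)) *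
        (lo * ((max |sInf ((fun x : ℝ => frameLevel μ K (S - levelPoint μ K 0 (x + θ))) '' Icc α β)| lo)⁻¹ *
          (Real.sqrt (max |sInf ((fun x : ℝ => frameLevel μ K (S - levelPoint μ K 0 (x + θ))) '' Icc α β)| lo))⁻¹)) := by
  set B := (bandBounds (show (-4 : ℝ) < -1.1 by norm_num) (show (-1.1 : ℝ) ≤ -0.1 by norm_num) (show (-0.1 : ℝ) < 0 by norm_num)) with hBdef
  set v : Momentum := WithLp.toLp 2 (fun i => 2 * π * (m i : ℝ)) with hv
  have hADt : 2 * A < B.Dtmin := by have := klCurveD_pos; linarith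
  have hDt : 0 < B.Dtmin - 2 * A := by linarith
  have hK₂0 : 0 ≤ K₂ := (norm_nonneg _).trans (hK₂ 0)
  have hu : 0 < B.umin := B.umin_pos
  have hwp : 0 < w := hG.wmin_pos
  have hc₂ : 0 < w * B.umin ^ 2 := by positivity
  have hhi0 : 0 ≤ hi := hlo0.le.trans hlohi
  have h0r : |(0 : ℝ)| < r := by rw [abs_zero]; exact hr
  have h0I : (0 : ℝ) ∈ Icc (-hi) hi := ⟨by linarith, hhi0⟩
  have hM : 0 ≤ msD A₃ A₄ 1 := (norm_nonneg _).trans (norm_iteratedDeriv_levelPoint_le hA hA20 hd hlo hhi hA₃ hA₄ h0r le_rfl (by norm_num) 0)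
  have hαβ : α ≤ β := hx₀.1.trans hx₀.2
  have hloI : lo ∈ Icc lo hi := left_mem_Icc.2 hlohi
  have hX00 : 0 ≤ X₀ := (abs_nonneg _).trans (hX0 lo hloI x₀ hx₀)
  have hW0 : 0 ≤ W := (hw0 lo hloI).trans (hwW lo hloI)
  have hMρ0 : 0 ≤ Mρ := by
    have h := hρtail lo hloI
    rw [div_self hlo0.ne', one_pow, mul_one] at h
    have h0 : 0 ≤ ∫ s in lo..hi, ρ s := intervalIntegral.integral_nonneg hlohi fun s hs => hρ0 s hs
    nlinarith
  -- the package
  obtain ⟨vs, hvs, hcurv, hinf, -, -⟩ :=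
    partnerBand_foldBox_package hA hA20 hd hr hlo hhi hA₃ hA₄ hK₁ hK₂ hK₃ hG S m θ hx₀ hWα hWβ hWφ hhi0 hhir hwin hslope hrate
  set δ₀ : ℝ := frameLevel μ K (S - levelPoint μ K 0 (vs 0 + θ)) with hδ₀def
  rw [hinf] at hδ₀ ⊢
  have hg0 : ContDiff ℝ 2 (fun x : ℝ => frameLevel μ K (S - levelPoint μ K 0 (x + θ))) := contDiff_partnerBand_angle hA hd hlo hhi S h0r θ
  have hmin : ∀ y ∈ Icc α β, δ₀ ≤ frameLevel μ K (S - levelPoint μ K 0 (y + θ)) := fun y hy =>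
    le_of_fold_of_convex hg0 (hvs 0 h0I).1 (hvs 0 h0I).2 (fun t ht => hc₂.le.trans (hcurv 0 h0I t ht).1) hy
  -- the quadratic growth of `D(y) = ē(0,y)` away from the fold point
  have hDq : ∀ y ∈ Icc α β, δ₀ + w * B.umin ^ 2 / 2 * (y - vs 0) ^ 2 ≤ frameLevel μ K (S - levelPoint μ K 0 (y + θ)) := fun y hy => by
    have h := fold_quadratic (g := fun x : ℝ => frameLevel μ K (S - levelPoint μ K 0 (x + θ))) hg0 (by positivity : 0 < w * B.umin ^ 2 / 2)
      (fun t ht => by have := (hcurv 0 h0I t ht).1; linarith) (hvs 0 h0I).1 (fun t ht => hmin t ht) hy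
    rw [hδ₀def]; linarith
  -- the rate window along every line of the box, levels below the Fermi surface
  have hratey : ∀ y ∈ Icc α β, ∀ σ ∈ Icc (-hi) 0, K₂ * ‖S - v - (2 : ℝ) • levelPoint μ K σ (y + θ)‖ / (B.Dtmin - 2 * A) ≤ 1 / 2 := by
    intro y hy σ hσ
    have hσr : |σ| < r := abs_lt.2 ⟨by linarith [hσ.1], by linarith [hσ.2]⟩
    have hD' := norm_caustic_sub_two_smul_le hA hA20 hd hlo hhi hA₃ hA₄ S v hσr θ x₀ y
    refine le_trans ?_ hrate
    refine div_le_div_of_nonneg_right (mul_le_mul_of_nonneg_left (hD'.trans ?_) hK₂0) hDt.le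
    have h1 : |σ| / (B.Dtmin - 2 * A) ≤ hi / (B.Dtmin - 2 * A) :=
      div_le_div_of_nonneg_right (by rw [abs_le]; constructor <;> linarith [hσ.1, hσ.2]) hDt.le
    have h2 : msD A₃ A₄ 1 * |y - x₀| ≤ msD A₃ A₄ 1 * Wφ := mul_le_mul_of_nonneg_left (hWφ y hy) hM
    linarith
  -- the angle layer with `A₂ = A₃ = 0`
  have hangle := intervalIntegral_pre_caustic_angle_le
    (F := fun y => |∫ s in lo..hi, wt s * X s y * deriv (Kr s) (frameLevel μ K (S - levelPoint μ K (-s) (y + θ)))|)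
    (D := fun y => frameLevel μ K (S - levelPoint μ K 0 (y + θ)))
    (A₁ := 5 * (W * X₀ * Mρ)) (A₂ := 0) (A₃ := 0)
    (hvs 0 h0I).1 (by positivity : 0 < w * B.umin ^ 2 / 2) hδ₀ hlo0 (by positivity) le_rfl le_rfl (fun y _ => abs_nonneg _) hDq
    fun y hy => by
      have h := abs_levelLine_partnerBand_pre_below_le hA hd hr hlo hhi hK₂ S m θ (hδ₀.trans_le (hmin y hy)) hlo0 hlohi hhir (hratey y hy)
        hK1 hρ0 hρc hρtail hKc hwc hw0 hwW (hXc y hy) (fun s hs => hX0 s hs y hy)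
      simpa only [zero_mul, add_zero] using h
  refine hangle.trans ?_
  -- the value in dispatch shape (`B = B′ = 0`)
  rw [abs_of_pos hδ₀]
  set m₀ := max δ₀ lo with hm₀
  have hm₀pos : 0 < m₀ := lt_max_of_lt_right hlo0
  have hsc : 0 < Real.sqrt (w * B.umin ^ 2 / 2) := Real.sqrt_pos.2 (by positivity)
  have hsm : 0 < Real.sqrt m₀ := Real.sqrt_pos.2 hm₀pos
  have hid : 2 * (5 * (W * X₀ * Mρ) * (16 * lo / (3 * Real.sqrt (w * B.umin ^ 2 / 2) * (m₀ * Real.sqrt m₀)))) =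
      32 * (5 * (W * X₀ * Mρ)) / (3 * Real.sqrt (w * B.umin ^ 2 / 2)) * (lo * (m₀⁻¹ * (Real.sqrt m₀)⁻¹)) := by
    field_simp
    ring
  simp only [zero_mul, mul_zero, add_zero]
  rw [hid]

end Sizes

end Summit.HubbardSuperconductivity.HubbardSuperconductivity.Theorems.C4a

end
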